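import Literature.Geometry.Lorentzian.KerrAxialSymmetryCovariant
import Literature.Geometry.Lorentzian.ChartConnection
import HarnessLib

/-!
# The axial Killing field `∂_φ = x₁ ∂₂ − x₂ ∂₁` of the Kerr–Schild chart is Killing
# (discharge of the named fact `Kerr.isKillingField_axialField`)

Family `gr`; namespaces `Literature.Geometry.Lorentzian.E4`, `.Minkowski`, `.Kerr`.

`KerrSchild.lean` states, as the named fact `Kerr.isKillingField_axialField M a r₀`, that the axial
field `Kerr.axialField a r₀ : x ↦ x₁ ∂₂ − x₂ ∂₁` is a Killing field of the Kerr metric in Kerr–Schild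
form on every chart domain `Kerr.region a r₀` (O'Neill 1995, Ch. 2, §2.2: `∂_φ` is Killing). This
file **proves** it (`Kerr.isKillingField_axialField_holds`), together with its `C^∞` twin
`Kerr.isKillingField_axialField_smoothMetric` for `Kerr.smoothMetric`, following the textbook
argument "the flow of `∂_φ` — the rotations `R_α` about the `z`-axis — consists of isometries":

* the **finite invariance** `g_{R_α x}(R_α v, R_α w) = g_x(v, w)` of the Kerr–Schild form
  `g = η + 2H ℓ ⊗ ℓ` is `Kerr.bilin_axialRotation` (`KerrAxialSymmetryCovariant.lean`);
* `E4.axialGenerator`, `E4.hasDerivAt_axialRotation` — the generator `J v = v₁ ∂₂ − v₂ ∂₁` of the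
  rotation group, `d/dα R_α v = J (R_α v)`, and `Kerr.axialField a r₀ x = J x`;
* `Kerr.fderiv_bilin_axialGenerator` — **infinitesimal invariance**, the `α`-derivative at `0` of
  the finite invariance: `DG_x(J x)(v, w) + G_x(J v, w) + G_x(v, J w) = 0`;
* `Kerr.isKillingField_axialField_smoothMetric`, `Kerr.isKillingField_axialField_holds` — the
  Killing equation `g(∇_v Y, w) + g(v, ∇_w Y) = 0`: by the coordinate formula for the Levi-Civita
  connection on arbitrary fields (`OpensChart.leviCivita_apply_eq`: `∇_v Y = J v + Γ_x(Y x)(v)`)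
  and the Koszul form of `Γ` (`OpensChart.two_mul_val_christoffel`), the left-hand side equals
  `G(J v, w) + G(v, J w) + DG(J x)(v, w)`, which vanishes by infinitesimal invariance
  (O'Neill 1983, Ch. 9, Prop. 9.25: `X` is Killing iff `𝓛_X g = 0` iff the flow is isometric);
  the analytic statement follows because `Kerr.smoothMetric = (Kerr.metric).ofLE _` has the same
  components, hence the same Levi-Civita connection (`PseudoRiemannianMetric.leviCivita_ofLE`).

No new named fact is introduced; the file discharges one (net debt `−1`).

## References

* B. O'Neill, *The geometry of Kerr black holes*, A K Peters 1995, Ch. 2, §2.2 (the Killing fields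
  `∂_t`, `∂_φ` of Boyer–Lindquist / Kerr–Schild coordinates; axial symmetry) (key `ONeill1995`).
* B. O'Neill, *Semi-Riemannian geometry*, Academic Press 1983, Ch. 3, Prop. 3.13 (the connection in
  coordinates); Ch. 9, Prop. 9.25 (Killing fields and local isometric flows) (key `ONeill1983`).
* R. P. Kerr, A. Schild, 1965, §2 (axial symmetry of the Kerr–Schild congruence) (key `KerrSchild1965`).
-/

noncomputable section

open Bundle Set Function TopologicalSpace
open scoped Manifold ContDiff Topology

namespace Literature.Geometry.Lorentzian

/-! ### The generator of the axial rotations -/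

namespace E4

/-- **The generator of the axial rotations**: `J v = v₁ ∂₂ − v₂ ∂₁`, i.e. `d/dα|₀ R_α v`, as a
continuous linear map; the axial field is `x ↦ J x`. O'Neill 1995, Ch. 2, §2.2 (`∂_φ = x ∂_y − y ∂_x`).
[cite: ONeill1995, Ch. 2 §2.2] -/
def axialGenerator : E4 →L[ℝ] E4 :=
  (EuclideanSpace.proj (1 : Fin 4) : E4 →L[ℝ] ℝ).smulRight (basisVector 2) -
    (EuclideanSpace.proj (2 : Fin 4) : E4 →L[ℝ] ℝ).smulRight (basisVector 1)

/-- `J v = v₁ ∂₂ − v₂ ∂₁`. [folklore] -/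
theorem axialGenerator_apply (v : E4) :
    axialGenerator v = (v 1) • basisVector 2 - (v 2) • basisVector 1 := by
  simp [axialGenerator]

/-- Components of `J v`: `(0, −v₂, v₁, 0)`. [folklore] -/
@[simp] theorem axialGenerator_apply_zero (v : E4) : axialGenerator v 0 = 0 := by
  simp [axialGenerator_apply]

/-- Components of `J v`: `(0, −v₂, v₁, 0)`. [folklore] -/
@[simp] theorem axialGenerator_apply_one (v : E4) : axialGenerator v 1 = -v 2 := by
  simp [axialGenerator_apply]

/-- Components of `J v`: `(0, −v₂, v₁, 0)`. [folklore] -/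
@[simp] theorem axialGenerator_apply_two (v : E4) : axialGenerator v 2 = v 1 := by
  simp [axialGenerator_apply]

/-- Components of `J v`: `(0, −v₂, v₁, 0)`. [folklore] -/
@[simp] theorem axialGenerator_apply_three (v : E4) : axialGenerator v 3 = 0 := by
  simp [axialGenerator_apply]

/-- `J ∂_{t*} = 0`: the generator kills the time axis (the rotations commute with time
translations). [folklore] -/
@[simp] theorem axialGenerator_basisVector_zero : axialGenerator (basisVector 0) = 0 := by
  ext i
  fin_cases i <;> simp

/-- The rotation as a combination of the coordinate vectors with trigonometric coefficients.
[folklore] -/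
theorem axialRotation_eq_sum (α : ℝ) (v : E4) :
    axialRotation α v = (v 0) • basisVector 0 +
      (Real.cos α * v 1 - Real.sin α * v 2) • basisVector 1 +
      (Real.sin α * v 1 + Real.cos α * v 2) • basisVector 2 + (v 3) • basisVector 3 := by
  ext i
  fin_cases i <;> simp

/-- **The rotations are the flow of `J`**: `d/dα R_α v = J (R_α v)`. O'Neill 1995, Ch. 2, §2.2.
[cite: ONeill1995, Ch. 2 §2.2] -/
theorem hasDerivAt_axialRotation (v : E4) (α : ℝ) :
    HasDerivAt (fun β ↦ axialRotation β v) (axialGenerator (axialRotation α v)) α := by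
  have hcos := Real.hasDerivAt_cos α
  have hsin := Real.hasDerivAt_sin α
  have h1 : HasDerivAt (fun β ↦ Real.cos β * v 1 - Real.sin β * v 2)
      (-Real.sin α * v 1 - Real.cos α * v 2) α :=
    (hcos.mul_const _).sub (hsin.mul_const _)
  have h2 : HasDerivAt (fun β ↦ Real.sin β * v 1 + Real.cos β * v 2)
      (Real.cos α * v 1 + -Real.sin α * v 2) α :=
    (hsin.mul_const _).add (hcos.mul_const _)
  have h : HasDerivAt (fun β ↦ (v 0) • basisVector 0 +
      (Real.cos β * v 1 - Real.sin β * v 2) • basisVector 1 +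
      (Real.sin β * v 1 + Real.cos β * v 2) • basisVector 2 + (v 3) • basisVector 3)
      ((0 : E4) + (-Real.sin α * v 1 - Real.cos α * v 2) • basisVector 1 +
        (Real.cos α * v 1 + -Real.sin α * v 2) • basisVector 2 + 0) α :=
    (((hasDerivAt_const α _).add (h1.smul_const _)).add (h2.smul_const _)).add
      (hasDerivAt_const α _)
  have hfun : (fun β ↦ axialRotation β v) = fun β ↦ (v 0) • basisVector 0 +
      (Real.cos β * v 1 - Real.sin β * v 2) • basisVector 1 +
      (Real.sin β * v 1 + Real.cos β * v 2) • basisVector 2 + (v 3) • basisVector 3 :=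
    funext fun β ↦ axialRotation_eq_sum β v
  rw [hfun]
  convert h using 1
  ext i
  fin_cases i <;> simp <;> ring

/-- At `α = 0`: `d/dα|₀ R_α v = J v`. [folklore] -/
theorem hasDerivAt_axialRotation_zero (v : E4) :
    HasDerivAt (fun β ↦ axialRotation β v) (axialGenerator v) 0 := by
  simpa using hasDerivAt_axialRotation v 0

end E4

/-! ### Infinitesimal invariance of the Kerr–Schild form -/

namespace Kerr

/-- The axial field is the generator evaluated at the point: `∂_φ(x) = J x`. [folklore] -/
theorem axialField_eq_axialGenerator (a r₀ : ℝ) (x : region a r₀) :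
    axialField a r₀ x = E4.axialGenerator (x : E4) := by
  rw [E4.axialGenerator_apply]
  rfl

set_option synthInstance.maxHeartbeats 200000 in
/-- **Infinitesimal invariance** (the `α`-derivative at `0` of `bilin_axialRotation`):
`DG_x(J x)(v, w) + G_x(J v, w) + G_x(v, J w) = 0` wherever the components are differentiable,
i.e. `𝓛_{∂_φ} g = 0` in coordinates. O'Neill 1983, Ch. 9, Prop. 9.25. [cite: ONeill1983, Ch. 9, Prop. 9.25] -/
theorem fderiv_bilin_axialGenerator (M a : ℝ) {x : E4} (hx : DifferentiableAt ℝ (bilin M a) x)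
    (v w : E4) :
    fderiv ℝ (bilin M a) x (E4.axialGenerator x) v w + bilin M a x (E4.axialGenerator v) w +
      bilin M a x v (E4.axialGenerator w) = 0 := by
  set c : ℝ → E4 := fun β ↦ E4.axialRotation β x with hc
  have hc0 : c 0 = x := E4.axialRotation_zero_apply x
  have hcd : HasDerivAt c (E4.axialGenerator x) 0 := E4.hasDerivAt_axialRotation_zero x
  have hGc : HasDerivAt (fun β ↦ bilin M a (c β)) (fderiv ℝ (bilin M a) x (E4.axialGenerator x)) 0 := by
    have hG : HasFDerivAt (bilin M a) (fderiv ℝ (bilin M a) x) (c 0) := by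
      rw [hc0]; exact hx.hasFDerivAt
    exact HasFDerivAt.comp_hasDerivAt (𝕜 := ℝ) (E := E4 →L[ℝ] E4 →L[ℝ] ℝ) (F := E4)
      (l := bilin M a) (l' := fderiv ℝ (bilin M a) x) (0 : ℝ) hG hcd
  have hv := E4.hasDerivAt_axialRotation_zero v
  have hw := E4.hasDerivAt_axialRotation_zero w
  have hF := (hGc.clm_apply hv).clm_apply hw
  have hconst : (fun β ↦ bilin M a (c β) (E4.axialRotation β v) (E4.axialRotation β w)) =
      fun _ ↦ bilin M a x v w := funext fun β ↦ bilin_axialRotation M a β x v w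
  rw [hconst] at hF
  have h0 := hF.unique (hasDerivAt_const 0 (bilin M a x v w))
  simp only [hc0, E4.axialRotation_zero_apply, _root_.add_apply] at h0
  linarith

end Kerr

/-! ### The Killing equation -/

namespace Kerr

/-- **The Killing identity in coordinates**: with `Γ_x(V)` the Christoffel map of the Kerr–Schild
components (`OpensChart.christoffel`), for `V = J x` the value of the axial field,
`G(J v + Γ_x(V) v, w) + G(v, J w + Γ_x(V) w) = 0` — by the Koszul form of `Γ`
(`OpensChart.two_mul_val_christoffel`) the left-hand side is `G(J v, w) + G(v, J w) + DG(J x)(v, w)`,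
which vanishes by `fderiv_bilin_axialGenerator`. O'Neill 1983, Ch. 9, Prop. 9.25.
[cite: ONeill1983, Ch. 9, Prop. 9.25] -/
theorem bilin_axialGenerator_add_christoffel {n : WithTop ℕ∞} [Fact (1 ≤ n)] [Facts] {M a r₀ : ℝ}
    (g : PseudoRiemannianMetric 𝓘(ℝ, E4) n E4 (TangentSpace 𝓘(ℝ, E4) : region a r₀ → Type _))
    (hG : ∀ y : region a r₀, g.val y = bilin M a y) (x : region a r₀) (v w : E4) :
    bilin M a x (E4.axialGenerator v +
        OpensChart.christoffel g (bilin M a) x (E4.axialGenerator (x : E4)) v) w +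
      bilin M a x v (E4.axialGenerator w +
        OpensChart.christoffel g (bilin M a) x (E4.axialGenerator (x : E4)) w) = 0 := by
  have hGx := differentiableAt_bilin M a x
  have h2 : 2 * bilin M a x (OpensChart.christoffel g (bilin M a) x (E4.axialGenerator (x : E4)) v) w =
      fderiv ℝ (bilin M a) x v (E4.axialGenerator (x : E4)) w +
        fderiv ℝ (bilin M a) x (E4.axialGenerator (x : E4)) w v -
        fderiv ℝ (bilin M a) x w v (E4.axialGenerator (x : E4)) := by
    have h := OpensChart.two_mul_val_christoffel (g := g) (G := bilin M a) x
      (E4.axialGenerator (x : E4)) v w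
    rw [OpensChart.koszulForm_apply, hG x] at h
    exact h
  have h3 : 2 * bilin M a x (OpensChart.christoffel g (bilin M a) x (E4.axialGenerator (x : E4)) w) v =
      fderiv ℝ (bilin M a) x w (E4.axialGenerator (x : E4)) v +
        fderiv ℝ (bilin M a) x (E4.axialGenerator (x : E4)) v w -
        fderiv ℝ (bilin M a) x v w (E4.axialGenerator (x : E4)) := by
    have h := OpensChart.two_mul_val_christoffel (g := g) (G := bilin M a) x
      (E4.axialGenerator (x : E4)) w v
    rw [OpensChart.koszulForm_apply, hG x] at h
    exact h
  have hinf := fderiv_bilin_axialGenerator M a hGx v w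
  have hs1 := fderiv_bilin_symm M a hGx v (E4.axialGenerator (x : E4)) w
  have hs2 := fderiv_bilin_symm M a hGx w (E4.axialGenerator (x : E4)) v
  have hs3 := fderiv_bilin_symm M a hGx (E4.axialGenerator (x : E4)) w v
  have hsym := bilin_symm M a x v
    (OpensChart.christoffel g (bilin M a) x (E4.axialGenerator (x : E4)) w)
  rw [map_add, _root_.add_apply, map_add, hsym]
  linear_combination (1 / 2 : ℝ) * h2 + (1 / 2 : ℝ) * h3 + (1 / 2 : ℝ) * hs1 +
    (1 / 2 : ℝ) * hs2 + (1 / 2 : ℝ) * hs3 + hinf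

/-- The axial field is a `C^n` section of the tangent bundle for every `n` (it is linear).
[folklore] -/
theorem contMDiffAt_axialField (a r₀ : ℝ) {n : WithTop ℕ∞} (x : region a r₀) :
    ContMDiffAt 𝓘(ℝ, E4) (𝓘(ℝ, E4).prod 𝓘(ℝ, E4)) n
      (fun y : region a r₀ ↦ (TotalSpace.mk' E4 y (axialField a r₀ y : TangentSpace 𝓘(ℝ, E4) y) :
        TangentBundle 𝓘(ℝ, E4) (region a r₀))) x := by
  rw [OpensChart.contMDiffAt_section_iff x (axialField a r₀),
    OpensChart.contMDiffAt_iff x _ E4.axialGenerator (axialField_eq_axialGenerator a r₀)]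
  exact E4.axialGenerator.contDiff.contDiffAt

/-- The Killing equation of the axial field for any regularity twin of the Kerr metric carrying
its Levi-Civita connection: `g(∇_v ∂_φ, w) + g(v, ∇_w ∂_φ) = 0`, from
`∇_v ∂_φ = J v + Γ_x(J x)(v)` (`OpensChart.leviCivita_apply_eq` needs the `C^∞` components, which
all twins share) and `bilin_axialGenerator_add_christoffel`. O'Neill 1995, Ch. 2, §2.2.
[cite: ONeill1995, Ch. 2 §2.2] -/
theorem killing_axialField_smoothMetric [Facts] (M a r₀ : ℝ) [(smoothMetric M a r₀).HasLeviCivita]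
    (x : region a r₀) (Y₀ Z₀ : TangentSpace 𝓘(ℝ, E4) x) :
    (smoothMetric M a r₀).val x ((smoothMetric M a r₀).toPseudoRiemannianMetric.leviCivita
        (axialField a r₀) x Y₀) Z₀ +
      (smoothMetric M a r₀).val x Y₀ ((smoothMetric M a r₀).toPseudoRiemannianMetric.leviCivita
        (axialField a r₀) x Z₀) = 0 := by
  set g := (smoothMetric M a r₀).toPseudoRiemannianMetric with hg
  have hG : ∀ y : region a r₀, g.val y = bilin M a y := fun y ↦ rfl
  have hlc : ∀ W : E4, g.leviCivita (axialField a r₀) x W =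
      E4.axialGenerator W + OpensChart.christoffel g (bilin M a) x (E4.axialGenerator (x : E4)) W := by
    intro W
    rw [OpensChart.leviCivita_apply_eq hG x (axialField_eq_axialGenerator a r₀)
      E4.axialGenerator.differentiableAt W, ContinuousLinearMap.fderiv, axialField_eq_axialGenerator]
  have key := bilin_axialGenerator_add_christoffel g hG x Y₀ Z₀
  rw [← hlc Y₀, ← hlc Z₀] at key
  exact key

/-- **`∂_φ` is a Killing field of the smooth Kerr metric** (`C^∞` twin of the named fact): the
section `x ↦ J x` is smooth (linear) and the Killing equation is `killing_axialField_smoothMetric`.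
O'Neill 1995, Ch. 2, §2.2; O'Neill 1983, Ch. 9, Prop. 9.25. [cite: ONeill1995, Ch. 2 §2.2] -/
theorem isKillingField_axialField_smoothMetric [Facts] (M a r₀ : ℝ)
    [(smoothMetric M a r₀).HasLeviCivita] :
    (smoothMetric M a r₀).toPseudoRiemannianMetric.IsKillingField (axialField a r₀) :=
  ⟨fun x ↦ by rw [ModelWithCorners.tangent]; exact contMDiffAt_axialField a r₀ x,
    fun x Y₀ Z₀ ↦ killing_axialField_smoothMetric M a r₀ x Y₀ Z₀⟩

/-- The analytic Kerr metric and its `C^∞` twin `Kerr.smoothMetric = (Kerr.metric).ofLE _` have the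
same components, hence (definitionally) the same Koszul connection: a Levi-Civita structure on one
is one on the other. [cite: ONeill1983, Ch. 3, Thm. 3.11] -/
theorem hasLeviCivita_smoothMetric_of_metric [Facts] (M a r₀ : ℝ) [h : (metric M a r₀).HasLeviCivita] :
    (smoothMetric M a r₀).HasLeviCivita :=
  ⟨h.out⟩

/-- … and the two Levi-Civita connections agree as functions. [cite: ONeill1983, Ch. 3, Thm. 3.11] -/
theorem leviCivita_smoothMetric_eq [Facts] (M a r₀ : ℝ) [(metric M a r₀).HasLeviCivita]
    [(smoothMetric M a r₀).HasLeviCivita] (Y : Π y : region a r₀, TangentSpace 𝓘(ℝ, E4) y)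
    (x : region a r₀) :
    (smoothMetric M a r₀).toPseudoRiemannianMetric.leviCivita Y x =
      (metric M a r₀).toPseudoRiemannianMetric.leviCivita Y x := by
  rw [PseudoRiemannianMetric.leviCivita_apply, PseudoRiemannianMetric.leviCivita_apply]
  rfl

/-- **Proof of the named fact `Kerr.isKillingField_axialField`**: `∂_φ = x₁ ∂₂ − x₂ ∂₁` is a
Killing field of the (analytic) Kerr metric on every chart domain, for all real `M, a, r₀`: the
section is analytic (linear), and the Killing equation is that of the `C^∞` twin
(`killing_axialField_smoothMetric`), the two metrics having the same components and the same
Levi-Civita connection (`leviCivita_smoothMetric_eq`). O'Neill 1995, Ch. 2, §2.2; O'Neill 1983,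
Ch. 9, Prop. 9.25. [cite: ONeill1995, Ch. 2 §2.2] -/
theorem isKillingField_axialField_holds : ∀ [Facts] (M a r₀ : ℝ), isKillingField_axialField M a r₀ := by
  intro _ M a r₀ _inst
  haveI := hasLeviCivita_smoothMetric_of_metric M a r₀
  refine ⟨fun x ↦ by rw [ModelWithCorners.tangent]; exact contMDiffAt_axialField a r₀ x,
    fun x Y₀ Z₀ ↦ ?_⟩
  have h := killing_axialField_smoothMetric M a r₀ x Y₀ Z₀
  rw [leviCivita_smoothMetric_eq] at h
  exact h

end Kerr

end Literature.Geometry.Lorentzian
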